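import Mathlib
import Literature.Computability.AlgebraicComplexity.RectangularExponent
import Literature.Computability.AlgebraicComplexity.RectangularExponentBounds
import Literature.Computability.AlgebraicComplexity.RectangularExponentHomogeneity
import Literature.Computability.AlgebraicComplexity.RectangularExponentAsymptoticRank
import Literature.Computability.AlgebraicComplexity.KroneckerRank

/-!
# MatrixMultiplication / ShapeSubmodularity — `ShapeSubmodular`, the ray `(2,2,c)`, `c ≥ 9`,
# is sandwichable

Route `ShapeSubmodularity`, crux `ShapeSubmodular` (stmt-MatrixMultiplication-15622), line
`registered` (RESHAPE 5), stub `stub_sandwichRay22`.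

Write `R⟨k, m, l⟩ = tensorRank (matMulTensor ℂ k m l)`.  The unit cell with meet `(2,2,c)`,
hypothesis formats `(3,2,c)`, `(2,3,c)` and join `(3,3,c)` is *sandwichable* when the join and the
meet admit exponents `u`, `u'` (`R⟨n^3, n^3, n^c⟩ = O(n^u)`, `R⟨n^2, n^2, n^c⟩ = O(n^{u'})`) with
`u + u' ≤ L(3,2,c) + L(2,3,c) = 2 (c + 3)` (`L` the flattening exponent).  This file proves that
every cell of the ray `(2,2,c)`, `c ≥ 9`, is sandwichable, CONDITIONALLY on the named fact
`vxxz2024_omegaRect_table` (Table 1 of Vassilevska Williams–Xu–Xu–Zhou, SODA 2024; a hypothesis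
of the theorem, unproved in the tree), of which only the row `κ = 3`, `ω(1, 3, 1) ≤ 4.198809`, is
used.

Proof.  `ω(1,3,1) = ω(1,1,3)` (`omegaRect_one_mid_one`) is the infimum of the admissible exponents
of `⟨n, n, ⌈n^3⌉⟩ = ⟨n, n, n^3⟩`, so `x := 4.199809 > 4.198809` is admissible
(`exists_lt_of_csInf_lt`, upward closure).  SCALING by `t = 3` and `t = 2`
(`mul_mem_rectAdmissibleExponents_smul`: the rank function of `(t, t, 3t)` at `n` is that of
`(1,1,3)` at `n^t`) gives `R⟨n^3, n^3, n^9⟩ = O(n^{3x})` and `R⟨n^2, n^2, n^6⟩ = O(n^{2x})`.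
Writing `c = 9 + d`, BLOCKING the last dimension (`R⟨k, m, l·t⟩ ≤ t · R⟨k, m, l⟩`, the Kronecker
product with `⟨1, 1, t⟩` of rank `≤ t`; Bläser 2013, Lemma 5.8 and p. 24) gives
`R⟨n^3, n^3, n^9 · n^d⟩ = O(n^{3x + d})` and `R⟨n^2, n^2, n^6 · n^{3+d}⟩ = O(n^{2x + 3 + d})`;
finally `u + u' = 5x + 2d + 3 = 23.999045 + 2d ≤ 24 + 2d = 2 (c + 3)`.
-/

-- (single-conjunct summit: the namespace repeats MatrixMultiplication)
set_option linter.dupNamespace false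

open Filter Asymptotics
open Literature.Computability.AlgebraicComplexity

namespace Summit.MatrixMultiplication.MatrixMultiplication.Theorems.ShapeSubmodular

/-! ## `O`-bookkeeping and blocking -/

/-- Extra factors of `n`: if `R' n ≤ n^e · R n` for all `n` and `R = O(n^β)`, then
`R' = O(n^{β + e})`. [folklore] -/
private theorem ray22_isBigO_mul_pow (R R' : ℕ → ℕ) (β : ℝ) (e : ℕ)
    (h : ∀ n : ℕ, R' n ≤ n ^ e * R n)
    (hO : (fun n : ℕ => (R n : ℝ)) =O[atTop] (fun n : ℕ => (n : ℝ) ^ β)) :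
    (fun n : ℕ => (R' n : ℝ)) =O[atTop] (fun n : ℕ => (n : ℝ) ^ (β + e)) := by
  -- adapted from `Theorems.ShapeSubmodular.cell_isBigO_mul` (stub_cellOfFlatMeet)
  have h1 : (fun n : ℕ => (R' n : ℝ)) =O[atTop] (fun n : ℕ => (R n : ℝ) * (n : ℝ) ^ e) := by
    refine IsBigO.of_bound 1 (Eventually.of_forall fun n => ?_)
    rw [one_mul, Real.norm_of_nonneg (Nat.cast_nonneg _), Real.norm_of_nonneg (by positivity)]
    calc (R' n : ℝ) ≤ ((n ^ e * R n : ℕ) : ℝ) := by exact_mod_cast h n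
      _ = (R n : ℝ) * (n : ℝ) ^ e := by push_cast; ring
  have h2 : (fun n : ℕ => (R n : ℝ) * (n : ℝ) ^ e) =O[atTop]
      (fun n : ℕ => (n : ℝ) ^ β * (n : ℝ) ^ e) :=
    hO.mul (isBigO_refl _ _)
  have h3 : (fun n : ℕ => (n : ℝ) ^ β * (n : ℝ) ^ e) =ᶠ[atTop]
      (fun n : ℕ => (n : ℝ) ^ (β + e)) := by
    filter_upwards [eventually_gt_atTop 0] with n hn0
    rw [Real.rpow_add (Nat.cast_pos.2 hn0), Real.rpow_natCast]
  exact (h1.trans h2).trans h3.isBigO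

/-- Blocking in the last dimension: `R⟨k, m, l·t⟩ ≤ t · R⟨k, m, l⟩` (Kronecker product with
`⟨1, 1, t⟩`, whose rank is `≤ t` by the standard algorithm).
[cite: Blaser2013, Lemma 5.8 and p. 24] -/
private theorem ray22_rank_mul_right_le (k m l t : ℕ) :
    tensorRank (matMulTensor ℂ k m (l * t)) ≤ t * tensorRank (matMulTensor ℂ k m l) := by
  -- adapted from `Theorems.ShapeSubmodular.cell_rank_mul_mid_le` (stub_cellOfFlatMeet)
  have h := Blaser2013_rank_matMulTensor_mul_le ℂ k m l 1 1 t
  rw [mul_one k, mul_one m] at h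
  calc tensorRank (matMulTensor ℂ k m (l * t))
        ≤ tensorRank (matMulTensor ℂ k m l) * tensorRank (matMulTensor ℂ 1 1 t) := h
    _ ≤ tensorRank (matMulTensor ℂ k m l) * t := by
        refine Nat.mul_le_mul_left _ ?_
        simpa using tensorRank_matMulTensor_le ℂ 1 1 t
    _ = t * tensorRank (matMulTensor ℂ k m l) := mul_comm _ _

/-! ## The record `ω(1,1,3) < 4.199809` in rank form, and its scalings -/

/-- From the row `κ = 3` of Table 1 of Vassilevska Williams–Xu–Xu–Zhou 2024 (hypothesis),
`ω(1,3,1) ≤ 4.198809`, and `ω(1,3,1) = ω(1,1,3) = inf (admissible exponents of ⟨n, n, ⌈n^3⌉⟩)`: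
`4.199809` is an admissible exponent of `(1, 1, 3)`. [folklore] -/
private theorem ray22_mem (h : vxxz2024_omegaRect_table) :
    (4.199809 : ℝ) ∈ rectAdmissibleExponents ℂ 1 1 3 := by
  have h131 : omegaRect ℂ 1 3 1 ≤ 4.198809 := h 3 4.198809 (by norm_num [vxxz2024Table])
  rw [omegaRect_one_mid_one ℂ 3] at h131
  have hinf : sInf (rectAdmissibleExponents ℂ 1 1 3) < 4.199809 := by
    unfold omegaRect at h131
    linarith
  obtain ⟨β, hβ, hβlt⟩ := exists_lt_of_csInf_lt (rectAdmissibleExponents_nonempty ℂ _ _ _) hinf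
  exact mem_rectAdmissibleExponents_of_le hβ hβlt.le

/-- Scaling a `(1,1,3)`-admissible exponent `x` by `t ≥ 1`: `R⟨n^t, n^t, n^{3t}⟩ = O(n^{t·x})`
(the rank function of `(t, t, 3t)` at `n` is that of `(1, 1, 3)` at `n^t`, and `⌈n^a⌉ = n^a` for
natural `a`). [folklore] -/
private theorem ray22_isBigO_smul {x : ℝ} (hx : x ∈ rectAdmissibleExponents ℂ 1 1 3) {t s : ℕ}
    (ht : 1 ≤ t) (hs : 3 * t = s) :
    (fun n : ℕ => (tensorRank (matMulTensor ℂ (n ^ t) (n ^ t) (n ^ s)) : ℝ)) =O[atTop]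
      fun n : ℕ => (n : ℝ) ^ ((t : ℝ) * x) := by
  have hmem := mul_mem_rectAdmissibleExponents_smul ℂ ht hx
  have e1 : ∀ n : ℕ, rectDim n ((t : ℝ) * 1) = n ^ t := fun n => by
    rw [mul_one, rectDim_natCast]
  have e3 : ∀ n : ℕ, rectDim n ((t : ℝ) * 3) = n ^ s := fun n => by
    rw [show (t : ℝ) * 3 = ((s : ℕ) : ℝ) by rw [← hs]; push_cast; ring, rectDim_natCast]
  have e : (fun n : ℕ => (tensorRank (matMulTensor ℂ (rectDim n ((t : ℝ) * 1))
      (rectDim n ((t : ℝ) * 1)) (rectDim n ((t : ℝ) * 3))) : ℝ)) =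
      fun n : ℕ => (tensorRank (matMulTensor ℂ (n ^ t) (n ^ t) (n ^ s)) : ℝ) :=
    funext fun n => by rw [tensorRank_matMulTensor_congr ℂ (e1 n) (e1 n) (e3 n)]
  rw [← e]
  exact hmem

/-! ## The stub -/

/-- **The ray `(2,2,c)`, `c ≥ 9`, is sandwichable** (stub `stub_sandwichRay22` of the line
`registered` of crux `ShapeSubmodular`), CONDITIONAL on the named fact `vxxz2024_omegaRect_table`
(Table 1 of Vassilevska Williams–Xu–Xu–Zhou 2024, taken as a hypothesis): for every `c ≥ 9` there
are `u, u'` with `u + u' ≤ 2 (c + 3)`, `R⟨n^3, n^3, n^c⟩ = O(n^u)` and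
`R⟨n^2, n^2, n^c⟩ = O(n^{u'})`.  With `x = 4.199809 > 4.198809 ≥ ω(1,3,1) = ω(1,1,3)` and
`c = 9 + d`: `u = 3x + d` (scale `(1,1,3)` by `3`, block the last dimension by `n^d`) and
`u' = 2x + 3 + d` (scale by `2`, block by `n^{3+d}`), so
`u + u' = 5x + 2d + 3 = 23.999045 + 2d ≤ 2 (c + 3)`. [folklore] -/
theorem stub_sandwichRay22 :
    Literature.Computability.AlgebraicComplexity.vxxz2024_omegaRect_table →
    ∀ c : ℕ, 9 ≤ c →
      ∃ u u' : ℝ, u + u' ≤ 2 * ((c : ℝ) + 3) ∧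
        (fun n : ℕ => (Literature.Computability.AlgebraicComplexity.tensorRank
          (Literature.Computability.AlgebraicComplexity.matMulTensor ℂ (n ^ 3) (n ^ 3) (n ^ c)) : ℝ))
            =O[Filter.atTop] (fun n : ℕ => (n : ℝ) ^ u) ∧
        (fun n : ℕ => (Literature.Computability.AlgebraicComplexity.tensorRank
          (Literature.Computability.AlgebraicComplexity.matMulTensor ℂ (n ^ 2) (n ^ 2) (n ^ c)) : ℝ))
            =O[Filter.atTop] (fun n : ℕ => (n : ℝ) ^ u') := by
  intro h c hc
  obtain ⟨d, rfl⟩ := Nat.exists_eq_add_of_le hc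
  -- `x = 4.199809` is `(1,1,3)`-admissible; scaled: `R⟨n^3,n^3,n^9⟩ = O(n^{3x})`,
  -- `R⟨n^2,n^2,n^6⟩ = O(n^{2x})`
  have hx := ray22_mem h
  have h3 := ray22_isBigO_smul hx (t := 3) (s := 9) (by norm_num) (by norm_num)
  have h2 := ray22_isBigO_smul hx (t := 2) (s := 6) (by norm_num) (by norm_num)
  refine ⟨((3 : ℕ) : ℝ) * 4.199809 + ((d : ℕ) : ℝ),
    ((2 : ℕ) : ℝ) * 4.199809 + ((3 + d : ℕ) : ℝ), ?_, ?_, ?_⟩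
  · -- `5x + 2d + 3 ≤ 2 (9 + d + 3)`
    push_cast
    linarith
  · -- block the last dimension of `⟨n^3, n^3, n^9 · n^d⟩`
    refine ray22_isBigO_mul_pow
      (fun n => tensorRank (matMulTensor ℂ (n ^ 3) (n ^ 3) (n ^ 9)))
      (fun n => tensorRank (matMulTensor ℂ (n ^ 3) (n ^ 3) (n ^ (9 + d)))) _ d (fun n => ?_) h3
    calc tensorRank (matMulTensor ℂ (n ^ 3) (n ^ 3) (n ^ (9 + d)))
          = tensorRank (matMulTensor ℂ (n ^ 3) (n ^ 3) (n ^ 9 * n ^ d)) :=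
        tensorRank_matMulTensor_congr ℂ rfl rfl (pow_add n 9 d)
      _ ≤ n ^ d * tensorRank (matMulTensor ℂ (n ^ 3) (n ^ 3) (n ^ 9)) :=
        ray22_rank_mul_right_le _ _ _ _
  · -- block the last dimension of `⟨n^2, n^2, n^6 · n^(3+d)⟩`
    have e : ∀ n : ℕ, n ^ (9 + d) = n ^ 6 * n ^ (3 + d) := fun n => by
      rw [← pow_add, show 6 + (3 + d) = 9 + d by omega]
    refine ray22_isBigO_mul_pow
      (fun n => tensorRank (matMulTensor ℂ (n ^ 2) (n ^ 2) (n ^ 6)))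
      (fun n => tensorRank (matMulTensor ℂ (n ^ 2) (n ^ 2) (n ^ (9 + d)))) _ (3 + d)
      (fun n => ?_) h2
    calc tensorRank (matMulTensor ℂ (n ^ 2) (n ^ 2) (n ^ (9 + d)))
          = tensorRank (matMulTensor ℂ (n ^ 2) (n ^ 2) (n ^ 6 * n ^ (3 + d))) :=
        tensorRank_matMulTensor_congr ℂ rfl rfl (e n)
      _ ≤ n ^ (3 + d) * tensorRank (matMulTensor ℂ (n ^ 2) (n ^ 2) (n ^ 6)) :=
        ray22_rank_mul_right_le _ _ _ _

end Summit.MatrixMultiplication.MatrixMultiplication.Theorems.ShapeSubmodular
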